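import Summits.HodgeConjecture.CorCM.AndreSplitWeilTypePolarized
import Literature.AlgebraicGeometry.ComplexMultiplication.CMAbelianVarietyRealisedHolds
import Literature.AlgebraicGeometry.ComplexMultiplication.CMTypeConjugateIsogeny
import Literature.NumberTheory.ComplexMultiplication.CMTypeBasic
import Literature.AlgebraicGeometry.HodgeTheory.CMProductsHodgeConjectureOfCodimTwo
import HarnessLib

/-!
# Ring 2 — Weil-type family-coverage census, CM-field rows (X-H): Deligne 1982 §5 (c) WITH POSITIVITY and an
# arbitrary RIGHT-SIGN target — for ANY CM field (the Galois hypothesis of part X-E removed)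

HONEST FRAMING: research route conditional on HC_CM; not a corollary; Q11.4-sentence-2 already refuted in dim ≥ 3.

Cell `pub-hodge-ring2`, seat `ring2-b03` (gen 55), census `WEIL-FAMILY-COVERAGE.md` «## b03» (the non-Galois `D₄` field
`ℚ(√-(3+√2))` included). THEOREMS ONLY: no `def`, no named fact, no `sorry`; `HC_CM` does not occur; nothing is a case
of the Hodge conjecture. Part X-E (`Ring2WeilCoverageCMFieldCellsKaehler`) proved the statement below under
`[IsGalois ℚ K]`, inherited from the CorCM lemma `AndreSplit.isWeilTypeCM_diagHom`; part X-G showed that binder is unused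
(`isWeilTypeCM_diagHom'`; a private copy is kept here). This file is part X-E's proof VERBATIM with it:

* `exists_kaehlerClass_hasWeilDiscriminantCM_of_constantSum_of_sign'` — for ANY CM field `K` with `[K:ℚ] > 2`,
  realisations `(B_j, Ψ_j)_{j<2p}` with constant sum `p`, Deligne's presentation `(b₀, R)`, and a unit `q ∈ F^×` with
  `(-1)^p Re τ(ι q) > 0` at every embedding: `⨁ B` is of CM type, and carries a rational class with a KÄHLER multiple, a polarization class,
  Rosati-compatible with `η = ⊕ act_j(b₀)`, with `HasWeilDiscriminantCM (⨁ B) η R e₀ p h [q]`.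
  (Its companion — the power member and the `iff` with part X-D for any CM field — is the next file.)

COUNT ONCE: the construction is Deligne's §5 (c) / the Literature and CorCM seats'; this file only removes a hypothesis.

## References
* [Deligne1982HodgeCycles] P. Deligne (notes by J. S. Milne), LNM 900 (1982), §4 p. 30 (1), Lemma 4.6; §5 (c) pp. 38–39.
* [Milne2020HodgeClassesAV] J. S. Milne, arXiv:2010.08857, §2 2.1–2.2.
-/

noncomputable section

set_option linter.dupNamespace false

namespace Summit.HodgeConjecture.HodgeConjecture.Ring2.WeilCoverageCM

open CategoryTheory CategoryTheory.Limits Polynomial NumberField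
open Literature.AlgebraicTopology.SingularHomology
open Literature.AlgebraicGeometry Literature.AlgebraicGeometry.Motives Literature.AlgebraicGeometry.HodgeTheory
open Literature.AlgebraicGeometry.ComplexMultiplication Literature.AlgebraicGeometry.Deligne1982
open Literature.AlgebraicGeometry.Milne1999
open Literature.Geometry.Kaehler (lefschetzPow HasHardLefschetzProperty)
open Literature.AlgebraicGeometry.VanGeemen1994 (pullbackOne)
open Literature.NumberTheory.Automorphic.PicardCM (eigenline)
open Literature.NumberTheory.QuadraticForms (Landherr.embedding_eq_re)
open Literature.NumberTheory.ComplexMultiplication (CMTypeOps.bar CMTypeOps.mem_bar_iff CMTypeOps.conjugate_mem_iff_notMem)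
open Summit.HodgeConjecture.CorCM.AndreProductForm Summit.HodgeConjecture.CorCM.Milne2020
open Summit.HodgeConjecture.CorCM.AndreSplit
open Summit.HodgeConjecture.HodgeConjecture.Theorems

/-! ## Deligne §5 (c) with positivity and an arbitrary right-sign target class — any CM field -/

section Polarized

variable (K : Type) [Field K] [NumberField K] [IsCMField K]

omit [IsCMField K] in
open scoped Classical in
/-- Private copy of part X-G's `isWeilTypeCM_diagHom'` (André's constant-sum products are of Weil type for ANY CM field;
the CorCM proof without its unused Galois binder), kept here so that this file does not wait for part X-G.
[cite: Deligne1982HodgeCycles, §4 Prop. 4.4 and §5 (c) p. 38] -/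
private theorem isWeilTypeCM_diagHom''
    {d p : ℕ} (hd : d = 2 * p) (hp : 0 < p) (B : Fin d → AbelianVariety ℂ)
    (act : ∀ j, 𝓞 K →+* End (B j)) {θB : ∀ j, K →+* Module.End ℂ (complexBetti (B j).X 1)}
    {Ψ : Fin d → CMType K} (hB : ∀ j, IsCMTypeRealisation (Ψ j) (B j) (act j) (θB j))
    (hadm : ∀ s : K →+* ℂ, (Finset.univ.filter fun j : Fin d => s ∈ (Ψ j).1).card = p)
    (b₀ : 𝓞 K) (hsep : Function.Injective fun σ : K →+* ℂ => σ (b₀ : K))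
    {R : Polynomial ℤ} {e₀ : ℕ} (he : Module.finrank ℚ K = 2 * e₀) (hRm : R.Monic) (hRdeg : R.natDegree = e₀)
    (hR : R.comp (X ^ 2) = minpoly ℤ b₀) (hirr : Irreducible (cmPolyQ R))
    (hroots : ∀ s : ℂ, Polynomial.eval₂ (Int.castRingHom ℂ) s R = 0 → s.im = 0 ∧ s.re < 0) :
    IsWeilTypeCM (⨁ B) (diagHom K B act b₀) R e₀ p := by
  subst hd
  have hv : ∀ j, ∃ v : Module.Basis (K →+* ℂ) ℂ (complexBetti (B j).X 1), ∀ σ, v σ ∈ eigenline (θB j) σ :=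
    fun j => exists_eigenbasis (hB j)
  choose vB hvB using hv
  have hfin : 0 < Module.finrank ℚ K := Module.finrank_pos
  have hdim : Module.finrank ℚ K * (2 * p) = 2 * (⨁ B).dim := by
    rw [two_mul_dim_biproduct B vB, Fintype.card_fin, ← NumberField.Embeddings.card K ℂ, mul_comm]
  refine ⟨by omega, hp, hRm, hRdeg, hirr, hroots, ?_, ?_, ?_⟩
  · rw [hR]
    exact eval₂_diagHom_minpoly K B act b₀
  · rw [he] at hdim
    have e : 2 * (⨁ B).dim = 2 * (2 * p * e₀) := by rw [← hdim]; ring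
    exact Nat.eq_of_mul_eq_mul_left two_pos e
  · intro ρ hρ
    rw [hR] at hρ
    obtain ⟨s, rfl⟩ := exists_embedding_of_root K b₀ hρ
    rw [eigenMultiplicity_diagHom_eq_card K B act hB b₀ hsep s, hadm s]

open scoped Classical in
/-- **André's constant-sum products carry a KÄHLER-polarized class of ANY prescribed RIGHT-SIGN discriminant — ANY CM
field `K`** with `[K:ℚ] > 2`, realisations `(B_j, Ψ_j)`, `j < d = 2p`, with constant sum `p`, `b₀ ∈ 𝓞_K` purely
imaginary separating with `R(T²) = minpoly_ℤ(b₀)`, and a unit `q ∈ F^×` with `(-1)^p · Re τ(ι q) > 0` at every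
embedding `τ : E → ℂ`: there is `h ∈ H²(⨁ B)` rational, with a Kähler multiple, a polarization class, Rosati-skew for
`η = ⊕ act_j(b₀)`, with `HasWeilDiscriminantCM (⨁ B) η R e₀ p h [q]`. The CorCM proof
(`exists_kaehlerClass_hyperbolic_of_constantSum`) with the slot-`0` twist multiplied by the totally positive real
`κ(ι((-1)^p q))`. [cite: Deligne1982HodgeCycles, §5 (c) pp. 38–39, §4 p. 30 (1), Lemma 4.6]
[cite: Milne2020HodgeClassesAV, §2 2.1–2.2] -/
theorem exists_kaehlerClass_hasWeilDiscriminantCM_of_constantSum_of_sign' (hK : 2 < Module.finrank ℚ K)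
    {d p : ℕ} (hd : d = 2 * p) (hp : 0 < p) (B : Fin d → AbelianVariety ℂ)
    (act : ∀ j, 𝓞 K →+* End (B j)) {θB : ∀ j, K →+* Module.End ℂ (complexBetti (B j).X 1)}
    {Ψ : Fin d → CMType K} (hB : ∀ j, IsCMTypeRealisation (Ψ j) (B j) (act j) (θB j))
    (hadm : ∀ s : K →+* ℂ, (Finset.univ.filter fun j : Fin d => s ∈ (Ψ j).1).card = p)
    {b₀ : 𝓞 K} (hb₀ : IsCMField.complexConj K (b₀ : K) = -(b₀ : K))
    (hsep : Function.Injective fun σ : K →+* ℂ => σ (b₀ : K))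
    {R : Polynomial ℤ} {e₀ : ℕ} (he : Module.finrank ℚ K = 2 * e₀) (hRm : R.Monic) (hRdeg : R.natDegree = e₀)
    (hR : R.comp (X ^ 2) = minpoly ℤ b₀) (hirr : Irreducible (cmPolyQ R))
    (hroots : ∀ s : ℂ, Polynomial.eval₂ (Int.castRingHom ℂ) s R = 0 → s.im = 0 ∧ s.re < 0)
    (haev : Polynomial.aeval (b₀ : K) (cmPolyQ R) = 0) (hdegQ : (cmPolyQ R).natDegree = Module.finrank ℚ K)
    [Fact (Irreducible (realPolyQ R))] {q : (realField R)ˣ}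
    (hqsign : ∀ τ : cmField R →+* ℂ, 0 < (-1 : ℝ) ^ p * (τ (realToCM R (q : realField R))).re) :
    IsOfCMType (⨁ B) ∧ IsWeilTypeCM (⨁ B) (diagHom K B act b₀) R e₀ p ∧
    ∃ h : complexBetti (⨁ B).X 2, IsRationalClass h ∧
      (∃ s : ℝ, s ≠ 0 ∧ IsKaehlerClass (⨁ B).dim (⨁ B).X ((s : ℂ) • h)) ∧
      IsPolarizationClass (⨁ B).dim (⨁ B).X h ∧
      (∀ x y : complexBetti (⨁ B).X 1,
        polarizationPairingOne (⨁ B).X h ((⨁ B).dim - 1) (pullbackOne (⨁ B) (diagHom K B act b₀) x) y =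
          -polarizationPairingOne (⨁ B).X h ((⨁ B).dim - 1) x (pullbackOne (⨁ B) (diagHom K B act b₀) y)) ∧
      HasWeilDiscriminantCM (⨁ B) (diagHom K B act b₀) R e₀ p h (QuotientGroup.mk q) := by
  obtain ⟨n, rfl⟩ : ∃ n, d = n + 1 := ⟨d - 1, by omega⟩
  have hk : n + 1 = 2 * p := hd
  have hW : IsWeilTypeCM (⨁ B) (diagHom K B act b₀) R e₀ p :=
    isWeilTypeCM_diagHom'' K hd hp B act hB hadm b₀ hsep he hRm hRdeg hR hirr hroots
  refine ⟨CMCodimTwo.isOfCMType_biproduct_fin B fun j => (hB j).isOfCMType, hW, ?_⟩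
  haveI hfE : Fact (Irreducible (cmPolyQ R)) := ⟨hirr⟩
  have hv : ∀ j, ∃ v : Module.Basis (K →+* ℂ) ℂ (complexBetti (B j).X 1), ∀ σ, v σ ∈ eigenline (θB j) σ :=
    fun j => exists_eigenbasis (hB j)
  choose b hbmem using hv
  have hb : ∀ a (c : 𝓞 K) (σ : K →+* ℂ),
      complexBetti.map (act a c : B a ⟶ B a).hom.hom.hom 1 (b a σ) = σ (c : K) • b a σ :=
    fun a c σ => map_ι_apply_of_mem_eigenline (hB a) (hbmem a σ) c
  have htype : ∀ a σ, σ ∈ (Ψ a).1 → IsOfHodgeType (B a).dim (B a).X 1 1 0 (b a σ) :=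
    fun a σ hσ => isOfHodgeType_oneZero_of_mem (hB a) (hbmem a σ) hσ
  have hdimB : ∀ a, (B a).dim = e₀ := fun a => by
    rw [dim_eq_of_isCMTypeRealisation (hB a), he, Nat.mul_div_cancel_left _ two_pos]
  have he2 : 2 ≤ e₀ := by omega
  have hdim2 : ∀ a, 2 ≤ (B a).dim := fun a => by rw [hdimB a]; exact he2
  have hdim0 : ∀ a, 0 < (B a).dim := fun a => by have := hdim2 a; omega
  have hAa : ∀ a, (B a).dim = ((B a).dim - 1) + 1 := fun a => by have := hdim0 a; omega
  have h2 : 2 ≤ (cmPolyQ R).natDegree := by rw [hdegQ]; omega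
  have hXdim0 : 0 < (⨁ B).dim := by have := hW.two_le_dim; omega
  obtain ⟨w, -, hw⟩ := exists_biproduct_eigenbasis (B := B) (u := fun a c => (act a c : B a ⟶ B a)) hb
  obtain ⟨Θ, hQΘ, -, ⟨s, hs0, hsΘ⟩, -, hkillΘ, -⟩ :=
    exists_rosati_kaehlerClass_of_eigenbasis_full (A := ⨁ B)
      (u := fun c => biproduct.map fun a => (act a c : B a ⟶ B a)) (τ := fun q : Fin (n + 1) × (K →+* ℂ) => q.2)
      hXdim0 hw
  set θ : ∀ a, complexBetti (B a).X 2 := fun a => complexBetti.map (biproduct.ι B a).hom.hom.hom 2 Θ with hθdef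
  have hK₁ : IsKaehlerClass (⨁ B).dim (⨁ B).X ((s : ℂ) • sumPolarizationClass B θ) := by
    have h1 := isKaehlerClass_smul_sum_map_blockProjection B hsΘ
    rwa [sum_map_blockProjection_eq_sumPolarizationClass] at h1
  have hQ₁ : ∀ a, IsRationalClass (θ a) := fun a => hQΘ.pullback _
  have hkill₁ : ∀ a (c : 𝓞 K), IsCMField.complexConj K (c : K) = -(c : K) →
      complexBetti.map (𝟙 (B a) + (show B a ⟶ B a from act a c)).hom.hom.hom 2 (θ a) =
        θ a + complexBetti.map (act a c : B a ⟶ B a).hom.hom.hom 2 (θ a) :=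
    fun a c hc => killed_map_ι B (fun a c => (act a c : B a ⟶ B a)) hkillΘ a c hc
  have hros₁ : ∀ a (c cc : 𝓞 K), (cc : K) = IsCMField.complexConj K (c : K) → ∀ x y : complexBetti (B a).X 1,
      polarizationPairingOne (B a).X (θ a) ((B a).dim - 1) (complexBetti.map (act a c : B a ⟶ B a).hom.hom.hom 1 x) y =
        polarizationPairingOne (B a).X (θ a) ((B a).dim - 1) x
          (complexBetti.map (act a cc : B a ⟶ B a).hom.hom.hom 1 y) :=
    fun a c cc hcc x y => rosati_of_killed (hdim0 a) (hb a) (hkill₁ a) c cc hcc x y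
  have htop₁ : ∀ a, lefschetzPow (θ a) ((B a).dim - 1) 2 (θ a) ≠ 0 :=
    lefschetzPow_self_ne_zero_of_sumPolarizationClass B θ hdim0
      (lefschetzPow_self_ne_zero_of_isKaehlerClass_smul hXdim0 hK₁)
  have hslot := fun a => exists_hermitianCoeff_of_rosatiClass_of_ne_zero (hdim2 a) (hb a) (hQ₁ a) (htop₁ a) (hros₁ a)
  choose x ζ hxQ hx0 hcomp hζ hcoef htr using hslot
  have hsign := hermitianCoeff_sign_uniform_of_isKaehlerClass_smul hdim2 hQ₁ hx0 hcomp hcoef Ψ htype ⟨s, hs0, hK₁⟩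
  have hζ0 : ∀ a, ζ a ≠ 0 := by
    intro a h0
    obtain ⟨σ⟩ : Nonempty (K →+* ℂ) := inferInstance
    have hno : ∀ τ : K →+* ℂ, τ ∉ (Ψ a).1 := by
      intro τ hτ
      rcases hsign with hs | hs
      · have h1 := (hs a τ).1 hτ
        rw [h0, map_zero, Complex.zero_im] at h1
        exact lt_irrefl _ h1
      · have h1 := (hs a τ).1 hτ
        rw [h0, map_zero, Complex.zero_im] at h1
        exact lt_irrefl _ h1
    exact hno σ (((Ψ a).2 σ).mpr (hno _))
  have hconst : ∀ τ : K →+* ℂ, (Finset.univ.filter fun a => 0 < (τ (ζ a)).im).card = p := by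
    intro τ
    rcases hsign with hs | hs
    · rw [← hadm τ]
      exact congrArg Finset.card (Finset.filter_congr fun a _ => (hs a τ).symm)
    · rw [← hadm (ComplexEmbedding.conjugate τ)]
      refine congrArg Finset.card (Finset.filter_congr fun a _ => ?_)
      rw [hs a (ComplexEmbedding.conjugate τ), ComplexEmbedding.conjugate_coe_eq, Complex.conj_im, neg_lt_zero]
  obtain ⟨f, hfreal, hfpos, hprod⟩ := SplitCriterion.exists_totallyPositive_rescaling ζ hζ hζ0 hconst (0 : Fin (n + 1))
  obtain ⟨κ, hκ⟩ := exists_algEquiv_cmField R haev hdegQ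
  set qs : (realField R)ˣ := (-1) ^ p * q with hqsdef
  set uK : K := κ (realToCM R (qs : realField R)) with huKdef
  have huKreal : IsCMField.complexConj K uK = uK := by
    rw [huKdef, ← algEquiv_cmConj R κ hκ hb₀, cmConj_realToCM]
  have hqsval : (qs : realField R) = (-1) ^ p * (q : realField R) := by
    rw [hqsdef, Units.val_mul, Units.val_pow_eq_pow_val, Units.val_neg, Units.val_one]
  have huKpos : ∀ τ : K →+* ℂ, 0 < (τ uK).re := by
    intro τ
    let τ' : cmField R →+* ℂ := τ.comp (κ : cmField R ≃ₐ[ℚ] K).toRingEquiv.toRingHom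
    have h2 : τ uK = (((-1 : ℝ) ^ p : ℝ) : ℂ) * τ' (realToCM R (q : realField R)) := by
      have h3 : τ' (realToCM R (q : realField R)) = τ (κ (realToCM R (q : realField R))) := rfl
      rw [h3, huKdef, hqsval, map_mul, map_pow, map_neg, map_one, map_mul, map_pow, map_neg, map_one, map_mul, map_pow,
        map_neg, map_one]
      push_cast
      rfl
    rw [h2, Complex.re_ofReal_mul]
    exact hqsign τ'
  obtain ⟨τ₀⟩ : Nonempty (K →+* ℂ) := inferInstance
  have huK0 : uK ≠ 0 := fun h0 => by
    have := huKpos τ₀; rw [h0, map_zero, Complex.zero_re] at this; exact lt_irrefl _ this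
  set g : K := ∏ a, f a with hgdef
  have hgreal : IsCMField.complexConj K g = g := by
    rw [hgdef, map_prod]; exact Finset.prod_congr rfl fun a _ => hfreal a
  have hgpos : ∀ τ : K →+* ℂ, 0 < (τ g).re := by
    intro τ
    have h1 : τ g = ((∏ a, (τ (f a)).re : ℝ) : ℂ) := by
      rw [hgdef, map_prod, Complex.ofReal_prod]
      exact Finset.prod_congr rfl fun a _ => Landherr.embedding_eq_re (hfreal a) τ
    rw [h1, Complex.ofReal_re]
    exact Finset.prod_pos fun a _ => hfpos a τ
  have hg0 : g ≠ 0 := fun h0 => by have := hgpos τ₀; rw [h0, map_zero, Complex.zero_re] at this; exact lt_irrefl _ this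
  set g' : K := g * uK with hg'def
  have hg'real : IsCMField.complexConj K g' = g' := by rw [hg'def, map_mul, hgreal, huKreal]
  have hg'pos : ∀ τ : K →+* ℂ, 0 < (τ g').re := by
    intro τ
    have h1 : τ uK = ((τ uK).re : ℂ) := (Landherr.embedding_eq_re huKreal τ)
    rw [hg'def, map_mul, h1, Complex.mul_re, Complex.ofReal_re, Complex.ofReal_im, mul_zero, sub_zero]
    exact mul_pos (hgpos τ) (huKpos τ)
  have hg'0 : g' ≠ 0 := mul_ne_zero hg0 huK0
  have halg : IsAlgebraic ℤ g' := (IsFractionRing.isAlgebraic_iff ℤ ℚ K).mpr (Algebra.IsAlgebraic.isAlgebraic g')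
  obtain ⟨M, hM0, hMint⟩ := halg.exists_integral_multiple
  rw [zsmul_eq_mul] at hMint
  obtain ⟨y, hy⟩ : ∃ y : 𝓞 K, (y : K) = (M : K) * g' :=
    ⟨⟨(M : K) * g', (mem_integralClosure_iff ℤ K).mpr hMint⟩, rfl⟩
  have hMK : (M : K) ≠ 0 := Int.cast_ne_zero.mpr hM0
  set ft : 𝓞 K := (M : 𝓞 K) * y with hftdef
  have hft : (ft : K) = (M : K) * ((M : K) * g') := by
    rw [← hy, hftdef, RingOfIntegers.coe_eq_algebraMap, map_mul, map_intCast]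
  have hftreal : IsCMField.complexConj K (ft : K) = ft := by
    rw [hft, map_mul, map_mul, map_intCast, hg'real]
  have hftpos : ∀ τ : K →+* ℂ, 0 < (τ (ft : K)).re := by
    intro τ
    have h1 : τ (ft : K) = (((M : ℝ) * M : ℝ) : ℂ) * τ g' := by
      rw [hft, map_mul, map_mul, map_intCast]; push_cast; ring
    rw [h1, Complex.re_ofReal_mul]
    exact mul_pos (mul_self_pos.mpr (Int.cast_ne_zero.mpr hM0)) (hg'pos τ)
  set F : Fin (n + 1) → 𝓞 K := fun a => if a = 0 then ft else 1 with hFdef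
  have hFval : ∀ a, (F a : K) = if a = 0 then (ft : K) else 1 := fun a => by
    by_cases ha : a = 0 <;> simp [hFdef, ha]
  have hFreal : ∀ a, IsCMField.complexConj K (F a : K) = F a := fun a => by
    rw [hFval]; split_ifs
    · exact hftreal
    · exact map_one _
  have hFpos : ∀ a (τ : K →+* ℂ), 0 < (τ (F a : K)).re := fun a τ => by
    rw [hFval]; split_ifs
    · exact hftpos τ
    · rw [map_one, Complex.one_re]; exact one_pos
  have hF0 : ∀ a, (F a : K) ≠ 0 := fun a h0 => by
    have := hFpos a τ₀; rw [h0, map_zero, Complex.zero_re] at this; exact lt_irrefl _ this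
  set T : ∀ a, complexBetti (B a).X 2 := fun a =>
    complexBetti.map (𝟙 (B a) + (show B a ⟶ B a from act a (F a))).hom.hom.hom 2 (θ a) - θ a -
      complexBetti.map (show B a ⟶ B a from act a (F a)).hom.hom.hom 2 (θ a) with hTdef
  have hK₂ : IsKaehlerClass (⨁ B).dim (⨁ B).X ((s : ℂ) • sumPolarizationClass B T) :=
    isKaehlerClass_smul_sumPolarizationClass_realTwist_of_totallyPositive (fun a c => (act a c : B a ⟶ B a))
      (τ := fun _ σ => σ) hb hkill₁ hFreal hFpos hK₁
  -- the twisted slot data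
  set ζ' : Fin (n + 1) → K := fun a => ζ a / (2 * (F a : K)) with hζ'def
  have hQT : ∀ a, IsRationalClass (T a) := fun a => isRationalClass_derivation _ (hQ₁ a)
  have hrosT : ∀ a (c cc : 𝓞 K), (cc : K) = IsCMField.complexConj K (c : K) → ∀ v w : complexBetti (B a).X 1,
      polarizationPairingOne (B a).X (T a) ((B a).dim - 1) (complexBetti.map (act a c : B a ⟶ B a).hom.hom.hom 1 v) w =
        polarizationPairingOne (B a).X (T a) ((B a).dim - 1) v
          (complexBetti.map (act a cc : B a ⟶ B a).hom.hom.hom 1 w) :=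
    fun a c cc hcc v w => realTwist_rosati (τ := fun σ : K →+* ℂ => σ) (hdim0 a) (hb a) (F a) (hkill₁ a) c cc hcc v w
  have htopT : ∀ a, lefschetzPow (T a) ((B a).dim - 1) 2 (T a) ≠ 0 := by
    intro a
    obtain ⟨dT, hdT0, -, htopTa, -⟩ :=
      exists_scalar_realTwist_self (hAa a) (hb a) (Ψ a) (hFreal a) (hF0 a) (hkill₁ a) (hros₁ a)
    rw [htopTa]
    exact smul_ne_zero hdT0 (htop₁ a)
  have hcoefT : ∀ a (σ : K →+* ℂ), polarizationPairingOne (B a).X (T a) ((B a).dim - 1)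
      ((b a).coord σ (x a) • b a σ)
      ((b a).coord (ComplexEmbedding.conjugate σ) (x a) • b a (ComplexEmbedding.conjugate σ)) =
      σ (ζ' a) • lefschetzPow (T a) ((B a).dim - 1) 2 (T a) :=
    fun a σ => realTwist_eigenCoeff (hAa a) (hb a) (Ψ a) (hFreal a) (hF0 a) (hkill₁ a) (hros₁ a) (hcoef a) σ
  have hζ' : ∀ a, IsCMField.complexConj K (ζ' a) = -ζ' a := fun a => imaginary_div_real (hζ a) (hFreal a)
  -- the product class: rational, Kähler multiple, polarization class, Rosati-skew
  have hQ₂ : IsRationalClass (sumPolarizationClass B T) := by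
    rw [sumPolarizationClass_def]
    exact isRationalClass_sum _ _ fun a _ => (hQT a).pullback _
  have hpol₂ : IsPolarizationClass (⨁ B).dim (⨁ B).X (sumPolarizationClass B T) :=
    isPolarizationClass_of_isKaehlerClass_smul hQ₂ ⟨s, hs0, hK₂⟩
  have hskew := polarizationPairingOne_sum_pullbackOne_diag_skew hb hdim0 hrosT hb₀
  -- the units `F'_a` with `ι F'_a = κ⁻¹(b₀ζ'_a)`
  have hb₀0 : (b₀ : K) ≠ 0 := by
    intro h0
    have hne : ComplexEmbedding.conjugate τ₀ ≠ τ₀ := by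
      rw [Ne, ← ComplexEmbedding.isReal_iff]
      exact IsTotallyComplex.complexEmbedding_not_isReal τ₀
    exact hne (hsep (by simp only [h0, map_zero]))
  have hζ'ne : ∀ a, ζ' a ≠ 0 := fun a => div_ne_zero (hζ0 a) (mul_ne_zero two_ne_zero (hF0 a))
  have hreal' : ∀ a, IsCMField.complexConj K ((b₀ : K) * ζ' a) = (b₀ : K) * ζ' a := fun a => by
    rw [map_mul, hb₀, hζ', neg_mul_neg]
  have hΦ := fun a => exists_realToCM_eq_symm R κ hκ hb₀ h2 (hreal' a)
  choose Φ hΦ using hΦ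
  have hΦ0 : ∀ a, Φ a ≠ 0 := fun a h0 => by
    have h1 := hΦ a
    rw [h0, map_zero, eq_comm, map_eq_zero_iff _ κ.symm.injective] at h1
    exact mul_ne_zero hb₀0 (hζ'ne a) h1
  let F' : Fin (n + 1) → (realField R)ˣ := fun a => Units.mk0 (Φ a) (hΦ0 a)
  have hF' : ∀ a, realToCM R (F' a) = κ.symm ((b₀ : K) * ζ' a) := fun a => by
    simp only [F', Units.val_mk0, hΦ]
  -- the real element `Y = (b₀ζ₀)^p / (2^p M g)` with `∏ b₀ζ'_a · uK = (-1)^p Y²`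
  set Y : K := ((b₀ : K) * ζ 0) ^ p / ((2 : K) ^ p * (M : K) * g) with hYdef
  have hζprod : g * ∏ a, ζ a = (-1) ^ p * ζ 0 ^ (n + 1) := by
    have h1 : ∏ a, f a * (ζ a / ζ 0) = g * (∏ a, ζ a) / ζ 0 ^ (n + 1) := by
      rw [Finset.prod_mul_distrib, Finset.prod_div_distrib, Finset.prod_const, Finset.card_univ, Fintype.card_fin,
        hgdef, mul_div_assoc]
    rw [h1, div_eq_iff (pow_ne_zero _ (hζ0 0))] at hprod
    exact hprod
  have hprodF : ∏ a, (F a : K) = (ft : K) := by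
    simp_rw [hFval]
    rw [Finset.prod_ite_eq', if_pos (Finset.mem_univ _)]
  have hkey : (∏ a, (b₀ : K) * ζ' a) * uK = (-1) ^ p * Y ^ 2 := by
    have h1 : ∏ a, (b₀ : K) * ζ' a = (b₀ : K) ^ (n + 1) * (∏ a, ζ a) / ((2 : K) ^ (n + 1) * (ft : K)) := by
      simp only [hζ'def]
      rw [Finset.prod_mul_distrib, Finset.prod_div_distrib, Finset.prod_mul_distrib, Finset.prod_const,
        Finset.prod_const, Finset.card_univ, Fintype.card_fin, hprodF, mul_div_assoc]
    have h2' : ∏ a, ζ a = (-1) ^ p * ζ 0 ^ (n + 1) / g := by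
      rw [eq_div_iff hg0, mul_comm, hζprod]
    have epow : ∀ z : K, z ^ (n + 1) = (z ^ p) ^ 2 := fun z => by rw [hk, pow_mul']
    rw [h1, h2', hft, hg'def, hYdef, epow, epow, epow]
    have h2K : (2 : K) ≠ 0 := two_ne_zero
    field_simp
    ring
  have hYreal : IsCMField.complexConj K Y = Y := by
    rw [hYdef, map_div₀, map_pow, map_mul, hb₀, hζ 0, neg_mul_neg, map_mul, map_mul, map_pow, map_ofNat,
      map_intCast, hgreal]
  have hY0 : Y ≠ 0 := by
    rw [hYdef]
    exact div_ne_zero (pow_ne_zero _ (mul_ne_zero hb₀0 (hζ0 0)))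
      (mul_ne_zero (mul_ne_zero (pow_ne_zero _ two_ne_zero) hMK) hg0)
  obtain ⟨y₀, hy₀⟩ := exists_realToCM_eq_symm R κ hκ hb₀ h2 hYreal
  have hy₀0 : y₀ ≠ 0 := by
    rintro rfl
    rw [map_zero, eq_comm, map_eq_zero_iff _ κ.symm.injective] at hy₀
    exact hY0 hy₀
  let w : (realField R)ˣ := Units.mk0 y₀ hy₀0
  -- `(∏ F'_a) · qs = (-1)^p · w²` in `F^×`, hence `[∏ F'_a] = [q]` (squares are norms, `(-1)^{2p} = 1`)
  have hprodF' : (∏ a, F' a) * qs = (-1) ^ p * w ^ 2 := by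
    apply Units.ext
    apply (realToCM R).injective
    apply κ.injective
    have lhs : κ (realToCM R (↑((∏ a, F' a) * qs))) = (∏ a, (b₀ : K) * ζ' a) * uK := by
      rw [Units.val_mul, map_mul, map_mul, Units.coe_prod, map_prod, map_prod, ← huKdef]
      congr 1
      exact Finset.prod_congr rfl fun a _ => by rw [hF', AlgEquiv.apply_symm_apply]
    have rhs : κ (realToCM R (↑((-1 : (realField R)ˣ) ^ p * w ^ 2))) = (-1) ^ p * Y ^ 2 := by
      simp only [w, Units.val_mul, Units.val_pow_eq_pow_val, Units.val_neg, Units.val_one, Units.val_mk0, map_mul,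
        map_pow, map_neg, map_one, hy₀, AlgEquiv.apply_symm_apply]
    rw [lhs, rhs, hkey]
  have hclass : (QuotientGroup.mk (∏ a, F' a) : cmNormResidueGroup R) = QuotientGroup.mk q := by
    have hm1 : ((-1 : (realField R)ˣ)) ^ p * (-1) ^ p = 1 := by
      rw [← pow_add, ← two_mul, pow_mul, neg_one_sq, one_pow]
    have hPF : ∏ a, F' a = w ^ 2 * q⁻¹ := by
      have h1 : (∏ a, F' a) = (-1) ^ p * w ^ 2 * qs⁻¹ := by rw [← hprodF', mul_inv_cancel_right]
      rw [h1, hqsdef, mul_inv, ← inv_pow, inv_neg_one]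
      calc (-1) ^ p * w ^ 2 * ((-1) ^ p * q⁻¹) = ((-1) ^ p * (-1) ^ p) * (w ^ 2 * q⁻¹) := by
            simp only [mul_comm, mul_left_comm, mul_assoc]
        _ = w ^ 2 * q⁻¹ := by rw [hm1, one_mul]
    rw [hPF, QuotientGroup.eq]
    have hmem : (w⁻¹ * q) ^ 2 ∈ normUnitsSubgroup (realField R) (cmField R) := by
      rw [← finrank_realField_cmField (R := R)]
      exact pow_finrank_mem_normUnitsSubgroup _
    have heq : (w ^ 2 * q⁻¹)⁻¹ * q = (w⁻¹ * q) ^ 2 := by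
      rw [mul_inv_rev, inv_inv, mul_pow, inv_pow, sq q, ← mul_assoc, mul_comm q (w ^ 2)⁻¹]
    rw [heq]
    exact hmem
  -- Deligne §5 (c) on the carriers: the discriminant of the product class of the twisted family
  have hdisc := hasWeilDiscriminantCM_sumPolarizationClass R hb hsep κ hκ he hk hQT htopT hrosT hxQ hx0 hcoefT hF'
  rw [hclass] at hdisc
  exact ⟨sumPolarizationClass B T, hQ₂, ⟨s, hs0, hK₂⟩, hpol₂, hskew, hdisc⟩

end Polarized

end Summit.HodgeConjecture.HodgeConjecture.Ring2.WeilCoverageCM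

end
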